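import Literature.Geometry.Manifold.PosDefOpen
import Literature.Topology.FourManifolds.ImmersionOrientation
import HarnessLib

/-!
# A metric extended from an embedded piece is Riemannian near the piece

Topic `Literature/Geometry/Riemannian` (namespace `Literature.Geometry.Riemannian`). Assembly
step of layer L1-(i) of the proof programme of `Literature.Geometry.Riemannian.BaerHankePscGluing`
(Bär–Hanke 2023, §3: the normal exponential map of a compact manifold with boundary `M` is taken
in an open manifold carrying an extension of the metric; in the tree's setting `M` sits in the
glued boundaryless manifold `P` through the smooth embedding `jM`). Once a `C^∞` symmetric field
`s` of bilinear forms on `TP` has been found whose pullback along `jM` is the Riemannian metric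
`gM` of the piece (`s_{jM a}(d jM v, d jM w) = gM_a(v, w)`; its construction is the Seeley
extension step, `RangeHalfSliceAtlas.lean` / `RangeDiffeomorph.lean` /
`HalfSliceAtlas.exists_contMDiff_forall_eq`), this file concludes:

* `posDef_of_pullback_eq` — `s` is positive definite at every point of `range jM`: the
  differential of the equidimensional immersion `jM` is a linear isomorphism `T_aM ≅ T_{jM a}P`
  also at boundary points (`injective_mfderiv_of_isImmersionAt'`, `ImmersionOrientation.lean`,
  plus `LinearMap.surjective_of_injective`);
* `exists_riemannianMetric_nhds_of_pullback_eq` — hence (`exists_riemannianMetric_opens_of_posDefOn`,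
  `PosDefOpen.lean`) there is an open submanifold `W ⊇ range jM` of `P` carrying a Riemannian
  `PseudoRiemannianMetric` equal to `s` pointwise — **a Riemannian metric on a neighbourhood of
  the piece extending its metric**.

Everything is proved; no definitions and no named facts are introduced.

## References

* C. Bär, B. Hanke, *Boundary conditions for scalar curvature*, arXiv:2012.09127, §3. [BarHanke2023]
* S. Lang, *Fundamentals of Differential Geometry* (1999), Ch. VII §1. [folklore]
-/

noncomputable section

open Bundle Set Function TopologicalSpace
open scoped Manifold ContDiff Topology

namespace Literature.Geometry.Riemannian

open Literature.Geometry.Lorentzian Literature.Geometry.Manifold Literature.Topology.FourManifolds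

variable {E : Type*} [NormedAddCommGroup E] [NormedSpace ℝ E] [FiniteDimensional ℝ E]
  {H : Type*} [TopologicalSpace H] {I : ModelWithCorners ℝ E H}
  {G : Type*} [TopologicalSpace G] {J : ModelWithCorners ℝ E G}
  {M : Type*} [TopologicalSpace M] [ChartedSpace H M] [IsManifold I ∞ M]
  {P : Type*} [TopologicalSpace P] [ChartedSpace G P] [IsManifold J ∞ P]

omit [IsManifold J ∞ P] in
/-- **An extension of the metric of a piece is positive definite on the piece.** If
`jM : M → P` is a `C^∞` immersion between manifolds on the same model vector space (e.g. an
equidimensional smooth embedding of a manifold with boundary) and the field `s` of bilinear forms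
on `TP` pulls back along `jM` to a Riemannian metric `gM` (`s_{jM a}(d jM v, d jM w) = gM_a(v,w)`),
then `s` is positive definite at every point `jM a`: `d(jM)_a` is injective
(`injective_mfderiv_of_isImmersionAt'`, also at boundary points) hence, the model spaces being
equal, surjective. [cite: BarHanke2023, §3] -/
theorem posDef_of_pullback_eq {jM : M → P} (hjM : Manifold.IsImmersion I J ∞ jM)
    (gM : PseudoRiemannianMetric I ∞ E (TangentSpace I : M → Type _)) (hg : gM.IsRiemannian)
    {s : Π p : P, TangentSpace J p →L[ℝ] TangentSpace J p →L[ℝ] ℝ}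
    (hpull : ∀ (a : M) (v w : TangentSpace I a),
      s (jM a) (mfderiv I J jM a v) (mfderiv I J jM a w) = gM.val a v w)
    {p : P} (hp : p ∈ range jM) (v : TangentSpace J p) (hv : v ≠ 0) : 0 < s p v v := by
  obtain ⟨a, rfl⟩ := hp
  haveI : FiniteDimensional ℝ (TangentSpace I a) := inferInstanceAs (FiniteDimensional ℝ E)
  have hinj : Injective (mfderiv I J jM a) :=
    injective_mfderiv_of_isImmersionAt' (hjM.isImmersionAt a)
  have hsurj : Surjective (mfderiv I J jM a) :=
    LinearMap.surjective_of_injective (f := ((mfderiv I J jM a : TangentSpace I a →L[ℝ]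
      TangentSpace J (jM a)) : TangentSpace I a →ₗ[ℝ] TangentSpace J (jM a))) hinj
  obtain ⟨u, rfl⟩ := hsurj v
  have hu : u ≠ 0 := fun h0 ↦ hv (by rw [h0, map_zero])
  rw [hpull a u u]
  exact hg a u hu

/-- **A Riemannian metric on a neighbourhood of the piece, extending its metric.** With `jM`,
`gM`, `s` as in `posDef_of_pullback_eq`, if moreover `s` is a `C^n` section of
`Hom(TP, Hom(TP, ℝ))` and symmetric, then there is an open submanifold `W ⊇ range jM` of `P` and a
Riemannian `C^n` pseudo-Riemannian metric `gW` on `W` with `gW = s` pointwise (the positivity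
locus of `s`, `exists_riemannianMetric_opens_of_posDefOn`). In the proof programme of
`BaerHankePscGluing` this is the open manifold in which the normal exponential map of the piece is
taken (Bär–Hanke 2023, §3). [cite: BarHanke2023, §3] -/
theorem exists_riemannianMetric_nhds_of_pullback_eq {n : ℕ∞ω} {jM : M → P}
    (hjM : Manifold.IsImmersion I J ∞ jM)
    (gM : PseudoRiemannianMetric I ∞ E (TangentSpace I : M → Type _)) (hg : gM.IsRiemannian)
    {s : Π p : P, TangentSpace J p →L[ℝ] TangentSpace J p →L[ℝ] ℝ}
    (hs : ContMDiff J (J.prod 𝓘(ℝ, E →L[ℝ] E →L[ℝ] ℝ)) n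
      (fun p : P ↦ TotalSpace.mk' (E →L[ℝ] E →L[ℝ] ℝ)
        (E := fun q : P ↦ TangentSpace J q →L[ℝ] TangentSpace J q →L[ℝ] ℝ) p (s p)))
    (hsymm : ∀ (p : P) (v w : TangentSpace J p), s p v w = s p w v)
    (hpull : ∀ (a : M) (v w : TangentSpace I a),
      s (jM a) (mfderiv I J jM a v) (mfderiv I J jM a w) = gM.val a v w) :
    ∃ W : Opens P, range jM ⊆ (W : Set P) ∧
      ∃ gW : PseudoRiemannianMetric J n E (TangentSpace J : W → Type _),
        gW.IsRiemannian ∧ ∀ (p : W) (v w : TangentSpace J p), gW.val p v w = s p.1 v w :=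
  exists_riemannianMetric_opens_of_posDefOn hs hsymm
    fun _ hp v hv ↦ posDef_of_pullback_eq hjM gM hg hpull hp v hv

end Literature.Geometry.Riemannian

end
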